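import Literature.AlgebraicGeometry.GroupSchemes.FrobeniusKernelUnitComponent        -- ★ p845457 (FKw-ord): `existsUnique_kerι_relFrobeniusOver_fac`; ★ (FKw) `finrank_alg_eq_finrank_quotient_ker`
import Literature.AlgebraicGeometry.GroupSchemes.EtaleComplementSplitsUnitComponent   -- ★ (o-c3j): `isIso_tensorHom_comp_mul_of_etale`
import Literature.AlgebraicGeometry.GroupSchemes.FrobeniusKillsImage                  -- ★ p845347 (K-c3) `FrobKill.comp_relFrobeniusOver_eq_one_of_epi_mul`
import Literature.AlgebraicGeometry.GroupSchemes.IsIsoOrEtaleOfNatCard                -- ★ (O-b1k): `hom_finrank_eq_finrank_alg`, `finrank_alg_eq_natCard_sections_mul`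
import HarnessLib

/-!
# Frobenius kills a homomorphism that kills an étale closed subgroup of rank `q` in a `w`-block of rank `q²` (the «étale kernel» assembly)

Topic `Literature/AlgebraicGeometry/GroupSchemes`; namespace `Literature.AlgebraicGeometry.GroupSchemes.FrobKillEt`.  THEOREMS ONLY
(no definition, no instance, no notation, no named fact, no `sorry`).  Cell `hodgecm-mathlib` (D-0151), programme P6 «MOD» (crux hLiu418 =
stmt-HodgeConjecture-24832, `--supports`, count-neutral): DICT-constructor brick **(D3-ét) `stub_K3b` «FROB-KILL ASSEMBLY, étale kernel»** of the line
`Cruxes/HLiu418/Lines/F0_P6c_DictConstructors.lean` (desk F0P6c-plan (g2), 2026-09-01 16:31Z), statement = the stub with `kerFI` ∕ `IsAdm` ∕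
`IdealIsEtale` unfolded (§3 `comp_relFrobeniusOver_eq_one_of_isEtale`, closed by one `exact` at ED. 2).  HC_CM is proved only modulo the
printed citations until rung 0 closes; this file is generic and changes no count.

THE PRINT.  [Tate1997FiniteFlatGroupSchemes] (3.7): a finite commutative group scheme `G` over a perfect field is `G⁰ × G^{ét}`, `G⁰` the unit
component, `|G(k̄)| = rk G^{ét}`, and every homomorphism from a connected group factors through `G⁰`; [SGA3I] VII_A 4.1–4.3: the Frobenius
kernel `Ker F_{G∕k}` is an infinitesimal closed subgroup, functorial in `G`, so `Ker F_{G∕k} ⊆ G⁰`.  CONSEQUENCE typed here (the ORDINARY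
`w`-block of HEART-FROB §B: `G = 𝒜_x̄[𝔴]` of rank `q²`, `Ker F` of rank `q`, an étale line `V(I)` of rank `q`): if `G` is a finite commutative
`k`-group scheme (`k = k̄`) of rank `q²` whose Frobenius kernel `Ker F^n_{G∕k}` has rank `q`, and `I ⊂ Γ(G)` is a Hopf ideal of colength `q` with
`V(I) = Spec (Γ(G)⧸I)` ÉTALE, then `V(I)` has `q` rational points, so `|G(k)| ≥ q`, so `rk G⁰ = q² ∕ |G(k)| ≤ q = rk Ker F ≤ rk G⁰`: the unit
component IS the Frobenius kernel (`G⁰ ≫ F = 1`), `V(I) × G⁰ ⥲ G` ([Tate1997FiniteFlatGroupSchemes] (3.7), ★ (o-c3j)), and every homomorphism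
`φ : G → G′` killing `V(I)` satisfies `φ ≫ F^n_{G′∕k} = 1` (★ FrobKill: `φ F = F φ^{(q)}` dies on both factors).

* §1 POINTS OF `V(I)`: `isFinite_specOver_quotient_hom`, `finrank_alg_specOver_quotient` (`rk V(I) = dim Γ(G)⧸I`, ★ `ker_appTop_quotIncl`),
  **`natCard_hom_specOver_quotient`** (`|V(I)(k)| = dim Γ(G)⧸I` for `V(I)` étale, ★ `natCard_hom_eq_finrank_of_etale`),
  `finrank_quotient_le_natCard_hom` (`dim Γ(G)⧸I ≤ |G(k)|`).
* §2 THE UNIT COMPONENT IS THE FROBENIUS KERNEL: `finrank_alg_ker_relFrobeniusOver_eq` (`rk Ker F^n = dim Γ(G)⧸ker Γ(ι)`),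
  **`finrank_quotient_ker_le_finrank_alg_unitComponent`** (`rk Ker F^n ≤ rk G⁰`, ★ p845457 `existsUnique_kerι_relFrobeniusOver_fac`),
  `isIso_fac_of_finrank_le` and **`unitComponent_comp_relFrobeniusOver_eq_one`** (`rk G⁰ ≤ rk Ker F^n ⟹ G⁰ = Ker F^n`, `j_{G⁰} ≫ F^n = 1`;
  ★ `Over.isIso_of_isClosedImmersion_of_finrank_eq`).
* §3 ASSEMBLY: `finrank_alg_unitComponent_le` (`rk G = q², q ≤ |G(k)| ⟹ rk G⁰ ≤ q`, ★ `finrank_alg_eq_natCard_sections_mul`) and the closer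
  **`comp_relFrobeniusOver_eq_one_of_isEtale`**.

## References
* [Tate1997FiniteFlatGroupSchemes] J. Tate, *Finite flat group schemes*, in: Modular Forms and Fermat's Last Theorem (1997) — (3.7).
* [SGA3I] M. Demazure, A. Grothendieck (eds.), *SGA 3, Tome I*, Exp. VII_A §4, 4.1–4.3.
* [GortzWedhorn2023] U. Görtz, T. Wedhorn, *Algebraic Geometry II* (2023) — (27.1.1), §(27.2) p. 607 (closed subgroups ↔ Hopf ideals).
* [StacksProject] The Stacks Project — Tag 02KA (rank of a finite locally free morphism), Tag 00U3 (étale algebras over a field).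
-/

set_option autoImplicit false

-- Mathlib's `Over`/`Scheme` APIs and the transported group structure on the twist are stated across semireducible wrappers
-- (as in ★ `GroupSchemes/*`).
set_option backward.isDefEq.respectTransparency false

-- As in ★ (FKw) ∕ ★ FrobKill: statements of the shape `c ≫ F^n = 1` need the slow `One (T ⟶ G^{(p^n)})` instance search (Mathlib's scoped
-- `Hom.monoid` through the transported structure of the twist); no proof `maxHeartbeats` budget is raised.
set_option synthInstance.maxHeartbeats 200000

noncomputable section

open CategoryTheory CategoryTheory.Limits AlgebraicGeometry MonoidalCategory CartesianMonoidalCategory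

open scoped MonObj Obj

universe u

namespace Literature.AlgebraicGeometry.GroupSchemes.FrobKillEt

open Literature.AlgebraicGeometry.Motives GroupSchemeKernel AffineGroupScheme

variable {k : Type u} [Field k]

/-! ## §1 Rational points of the étale closed subscheme `V(I) = Spec (Γ(G) ⧸ I)` -/

section Points

variable (G : SchemeOver k) [IsAffine G.left] (I : Ideal (Alg G))

omit [IsAffine G.left] in
/-- `Spec (Γ(G) ⧸ I)` is affine (bookkeeping instance, stated as a theorem). [cite: GortzWedhorn2023, §(27.2) (p. 607)] -/
theorem isAffine_specOver_quotient_left : IsAffine (Motives.specOver k (Alg G ⧸ I)).left :=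
  inferInstanceAs (IsAffine (Spec (CommRingCat.of (Alg G ⧸ I))))

/-- `V(I) → Spec k` is finite when `G` is (a closed subscheme, ★ `isClosedImmersion_quotIncl_left`). [cite: GortzWedhorn2023, (27.1.1)] -/
theorem isFinite_specOver_quotient_hom [IsFinite G.hom] : IsFinite (Motives.specOver k (Alg G ⧸ I)).hom := by
  haveI := isClosedImmersion_quotIncl_left G I
  rw [← Over.w (quotIncl G I)]
  infer_instance

/-- **`rk V(I) = dim_k Γ(G) ⧸ I`**: the affine algebra of `Spec (Γ(G) ⧸ I) ↪ G` has the dimension of `Γ(G) ⧸ I` (its ideal is `I`, ★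
`ker_appTop_quotIncl`; ★ `finrank_alg_eq_finrank_quotient_ker`). [cite: GortzWedhorn2023, (27.1.1) and §(27.2) (p. 607)] -/
theorem finrank_alg_specOver_quotient :
    Module.finrank k (Alg (Motives.specOver k (Alg G ⧸ I))) = Module.finrank k (Alg G ⧸ I) := by
  haveI := isClosedImmersion_quotIncl_left G I
  haveI := isAffine_specOver_quotient_left G I
  have h : (RingHom.ker (quotIncl G I).left.appTop.hom : Ideal (Alg G)) = I := ker_appTop_quotIncl G I
  rw [finrank_alg_eq_finrank_quotient_ker (quotIncl G I)]
  exact (Ideal.quotientEquivAlgOfEq k h).toLinearEquiv.finrank_eq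

variable [IsAlgClosed k] [IsFinite G.hom]

/-- **`|V(I)(k)| = dim_k Γ(G) ⧸ I` when `V(I)` is ÉTALE** over the algebraically closed field `k` (a finite étale `k`-scheme is split: ★
`natCard_hom_eq_finrank_of_etale`). [cite: Tate1997FiniteFlatGroupSchemes, (3.7)] [cite: StacksProject, Tag 00U3] -/
theorem natCard_hom_specOver_quotient (hIet : Etale (Motives.specOver k (Alg G ⧸ I)).hom) :
    Nat.card (𝟙_ (SchemeOver k) ⟶ Motives.specOver k (Alg G ⧸ I)) = Module.finrank k (Alg G ⧸ I) := by
  haveI := isFinite_specOver_quotient_hom G I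
  haveI := hIet
  rw [natCard_hom_eq_finrank_of_etale (Motives.specOver k (Alg G ⧸ I)), ← finrank_alg_specOver_quotient G I]
  rfl

/-- **`dim_k Γ(G) ⧸ I ≤ |G(k)|`** for `V(I)` étale: the `q` rational points of `V(I)` are rational points of `G` (`quotIncl` is a monomorphism).
[cite: Tate1997FiniteFlatGroupSchemes, (3.7)] -/
theorem finrank_quotient_le_natCard_hom (hIet : Etale (Motives.specOver k (Alg G ⧸ I)).hom) [Finite (𝟙_ (SchemeOver k) ⟶ G)] :
    Module.finrank k (Alg G ⧸ I) ≤ Nat.card (𝟙_ (SchemeOver k) ⟶ G) := by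
  rw [← natCard_hom_specOver_quotient G I hIet]
  haveI := mono_quotIncl G I
  exact Nat.card_le_card_of_injective (fun g => g ≫ quotIncl G I) fun a b h => (cancel_mono (quotIncl G I)).mp h

end Points

/-! ## §2 The unit component is the Frobenius kernel as soon as its rank allows -/

section UnitIsKernel

variable (p : ℕ) [ExpChar k p] (n : ℕ) (G : SchemeOver k) [GrpObj G] [IsAffine G.left] [IsFinite G.hom]
  (U : SchemeOver k) [GrpObj U] [IsAffine U.left] (jU : U ⟶ G)

/-- **`rk Ker F^n_{G∕k} = dim_k Γ(G) ⧸ ker Γ(ι)`** (the closed subscheme `Ker F^n ↪ G`, ★ `isClosedImmersion_kerι_relFrobeniusOver_left`).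
[cite: SGA3I, VII_A 4.1–4.3] [cite: GortzWedhorn2023, (27.1.1)] -/
theorem finrank_alg_ker_relFrobeniusOver_eq :
    Module.finrank k (Alg (ker (relFrobeniusOver p n G))) =
      Module.finrank k (Alg G ⧸ (RingHom.ker (kerι (relFrobeniusOver p n G)).left.appTop.hom : Ideal (Alg G))) := by
  haveI := isClosedImmersion_kerι_relFrobeniusOver_left p n (G := G)
  exact finrank_alg_eq_finrank_quotient_ker (kerι (relFrobeniusOver p n G))

/-- **`rk Ker F^n ≤ rk G⁰`**: the Frobenius kernel lies in the unit component `jU : G⁰ ↪ G` (★ p845457 `existsUnique_kerι_relFrobeniusOver_fac`: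
`ι = v ≫ jU`), and `v` is a closed immersion, so `Γ(G⁰) ↠ Γ(Ker F^n)`. [cite: Tate1997FiniteFlatGroupSchemes, (3.7)] [cite: SGA3I, VII_A 4.1–4.3] -/
theorem finrank_quotient_ker_le_finrank_alg_unitComponent
    (hU : IsMonHom jU ∧ IsOpenImmersion jU.left ∧ IsClosedImmersion jU.left ∧ ConnectedSpace ↥U.left) :
    Module.finrank k (Alg G ⧸ (RingHom.ker (kerι (relFrobeniusOver p n G)).left.appTop.hom : Ideal (Alg G))) ≤
      Module.finrank k (Alg U) := by
  obtain ⟨hmon, hop, hcl, -⟩ := hU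
  haveI := hmon; haveI := hop; haveI := hcl
  obtain ⟨v, hv, -⟩ := existsUnique_kerι_relFrobeniusOver_fac p n jU
  haveI := isClosedImmersion_kerι_relFrobeniusOver_left p n (G := G)
  haveI : IsClosedImmersion (v.left ≫ jU.left) := by rw [← Over.comp_left, hv]; infer_instance
  haveI : IsClosedImmersion v.left := IsClosedImmersion.of_comp_isClosedImmersion v.left jU.left
  haveI : IsFinite U.hom := by rw [← Over.w jU]; infer_instance
  haveI : Module.Finite k (Alg U) := Alg.moduleFinite U
  rw [← finrank_alg_ker_relFrobeniusOver_eq p n G, finrank_alg_eq_finrank_quotient_ker v]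
  exact Submodule.finrank_quotient_le ((RingHom.ker v.left.appTop.hom : Ideal (Alg U)).restrictScalars k)

/-- **EQUAL-RANK RIGIDITY: `rk G⁰ ≤ rk Ker F^n ⟹` the factorisation `v : Ker F^n → G⁰` of `ι` through `jU` is an ISOMORPHISM** (a closed
immersion of finite `k`-schemes of the same rank, ★ `Over.isIso_of_isClosedImmersion_of_finrank_eq`; ranks read on the affine algebras, ★
`hom_finrank_eq_finrank_alg`). [cite: Tate1997FiniteFlatGroupSchemes, (3.7)] [cite: StacksProject, Tag 02KA] -/
theorem isIso_fac_of_finrank_le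
    (hU : IsMonHom jU ∧ IsOpenImmersion jU.left ∧ IsClosedImmersion jU.left ∧ ConnectedSpace ↥U.left)
    (v : ker (relFrobeniusOver p n G) ⟶ U) (hv : v ≫ jU = kerι (relFrobeniusOver p n G))
    (hle : Module.finrank k (Alg U) ≤
      Module.finrank k (Alg G ⧸ (RingHom.ker (kerι (relFrobeniusOver p n G)).left.appTop.hom : Ideal (Alg G)))) :
    IsIso v := by
  have hge := finrank_quotient_ker_le_finrank_alg_unitComponent p n G U jU hU
  obtain ⟨-, -, hcl, -⟩ := hU
  haveI := hcl
  haveI := isClosedImmersion_kerι_relFrobeniusOver_left p n (G := G)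
  haveI : IsClosedImmersion (v.left ≫ jU.left) := by rw [← Over.comp_left, hv]; infer_instance
  haveI : IsClosedImmersion v.left := IsClosedImmersion.of_comp_isClosedImmersion v.left jU.left
  haveI : IsFinite U.hom := by rw [← Over.w jU]; infer_instance
  haveI : IsFinite (ker (relFrobeniusOver p n G)).hom := by rw [← Over.w (kerι (relFrobeniusOver p n G))]; infer_instance
  haveI : Flat U.hom := flat_hom_of_field' U
  haveI : Flat (ker (relFrobeniusOver p n G)).hom := flat_hom_of_field' _
  have heq : Module.finrank k (Alg (ker (relFrobeniusOver p n G))) = Module.finrank k (Alg U) := by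
    rw [finrank_alg_ker_relFrobeniusOver_eq p n G]; omega
  exact Literature.AlgebraicGeometry.Morphisms.Over.isIso_of_isClosedImmersion_of_finrank_eq v fun s => by
    rw [hom_finrank_eq_finrank_alg (ker (relFrobeniusOver p n G)) s, hom_finrank_eq_finrank_alg U s, heq]

/-- **`rk G⁰ ≤ rk Ker F^n ⟹ G⁰ IS KILLED BY `F^n`** (`jU ≫ F^n_{G∕k} = 1`): then `G⁰ = Ker F^n` by `isIso_fac_of_finrank_le`, and `ι ≫ F^n = 1`
(★ `kerι_comp`). [cite: Tate1997FiniteFlatGroupSchemes, (3.7)] [cite: SGA3I, VII_A 4.1–4.3] -/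
theorem unitComponent_comp_relFrobeniusOver_eq_one
    (hU : IsMonHom jU ∧ IsOpenImmersion jU.left ∧ IsClosedImmersion jU.left ∧ ConnectedSpace ↥U.left)
    (hle : Module.finrank k (Alg U) ≤
      Module.finrank k (Alg G ⧸ (RingHom.ker (kerι (relFrobeniusOver p n G)).left.appTop.hom : Ideal (Alg G)))) :
    jU ≫ relFrobeniusOver p n G = 1 := by
  haveI := isMonHom_relFrobeniusOver p n G
  have hU' := hU
  obtain ⟨hmon, hop, hcl, -⟩ := hU
  haveI := hmon; haveI := hop; haveI := hcl
  obtain ⟨v, hv, -⟩ := existsUnique_kerι_relFrobeniusOver_fac p n jU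
  haveI := isIso_fac_of_finrank_le p n G U jU hU' v hv hle
  rw [← cancel_epi v, ← Category.assoc, hv, kerι_comp, MonObj.comp_one]

end UnitIsKernel

/-! ## §3 The assembly: an isogeny killing an étale admissible `V(I)` is killed by Frobenius -/

section Assembly

variable [IsAlgClosed k] (p : ℕ) [ExpChar k p] (n : ℕ)

/-- **`rk G = q²` and `q ≤ |G(k)|` force `rk G⁰ ≤ q`**, by Tate's count `rk G = |G(k)| · rk G⁰` (★ `finrank_alg_eq_natCard_sections_mul`;
`Γ(G) ≠ 0` gives `q ≠ 0`). [cite: Tate1997FiniteFlatGroupSchemes, (3.7)] -/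
theorem finrank_alg_unitComponent_le (G : SchemeOver k) [GrpObj G] [IsAffine G.left] [IsFinite G.hom]
    (U : SchemeOver k) [GrpObj U] [IsAffine U.left] (jU : U ⟶ G)
    (hU : IsMonHom jU ∧ IsOpenImmersion jU.left ∧ IsClosedImmersion jU.left ∧ ConnectedSpace ↥U.left) {q : ℕ}
    (hrkG : Module.finrank k (Alg G) = q * q) (hq : q ≤ Nat.card (𝟙_ (SchemeOver k) ⟶ G)) :
    Module.finrank k (Alg U) ≤ q := by
  obtain ⟨hmon, hop, hcl, hconn⟩ := hU
  haveI := hmon; haveI := hop; haveI := hcl; haveI := hconn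
  have hcount := finrank_alg_eq_natCard_sections_mul G U jU
  haveI : Nontrivial (Alg G) := nontrivial_alg_of_section G η[G]
  haveI : Module.Finite k (Alg G) := Alg.moduleFinite G
  have hpos : 0 < Module.finrank k (Alg G) := Module.finrank_pos
  have hq0 : 0 < q := by
    rcases Nat.eq_zero_or_pos q with h | h
    · rw [h, mul_zero] at hrkG; omega
    · exact h
  have h1 : q * Module.finrank k (Alg U) ≤ q * q :=
    calc q * Module.finrank k (Alg U) ≤ Nat.card (𝟙_ (SchemeOver k) ⟶ G) * Module.finrank k (Alg U) := Nat.mul_le_mul_right _ hq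
      _ = q * q := by rw [← hcount, hrkG]
  exact Nat.le_of_mul_le_mul_left h1 hq0

omit [IsAlgClosed k] in
/-- **THE SPLITTING `V(I) × G⁰ ⥲ G`** for an étale closed subgroup `V(I)` of rank `q` and the unit component `G⁰` of rank `q` in a finite
commutative `G` of rank `q²` (★ (o-c3j) `isIso_tensorHom_comp_mul_of_etale`, ranks read on affine algebras by ★ `hom_finrank_eq_finrank_alg`).
[cite: Tate1997FiniteFlatGroupSchemes, (3.7)] -/
theorem isIso_quotIncl_tensorHom_comp_mul (G : SchemeOver k) [GrpObj G] [IsCommMonObj G] [IsAffine G.left] [IsFinite G.hom]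
    (U : SchemeOver k) [GrpObj U] [IsAffine U.left] (jU : U ⟶ G)
    (hU : IsMonHom jU ∧ IsOpenImmersion jU.left ∧ IsClosedImmersion jU.left ∧ ConnectedSpace ↥U.left) {q : ℕ}
    (hrkG : Module.finrank k (Alg G) = q * q) (hUq : Module.finrank k (Alg U) = q)
    (I : Ideal (Alg G)) [GrpObj (Motives.specOver k (Alg G ⧸ I))] [IsMonHom (quotIncl G I)]
    (hIq : Module.finrank k (Alg G ⧸ I) = q) (hIet : Etale (Motives.specOver k (Alg G ⧸ I)).hom) :
    IsIso ((quotIncl G I ⊗ₘ jU) ≫ μ[G]) := by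
  obtain ⟨hmon, hop, hcl, hconn⟩ := hU
  haveI := hmon; haveI := hop; haveI := hcl; haveI := hconn
  haveI := isClosedImmersion_quotIncl_left G I
  haveI := hIet
  haveI := isFinite_specOver_quotient_hom G I
  haveI : IsFinite U.hom := by rw [← Over.w jU]; infer_instance
  have hV : ∀ s, (Motives.specOver k (Alg G ⧸ I)).hom.finrank s = q := fun s => by
    rw [hom_finrank_eq_finrank_alg (Motives.specOver k (Alg G ⧸ I)) s, finrank_alg_specOver_quotient, hIq]
  have hUs : ∀ s, U.hom.finrank s = q := fun s => by rw [hom_finrank_eq_finrank_alg U s, hUq]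
  have hGs : ∀ s, G.hom.finrank s = q * q := fun s => by rw [hom_finrank_eq_finrank_alg G s, hrkG]
  exact isIso_tensorHom_comp_mul_of_etale jU (quotIncl G I) fun s => by rw [hV s, hUs s, hGs s]

omit [IsAlgClosed k] in
/-- Swapping the factors of a product map into a COMMUTATIVE group object: `β ≫ (i ⊗ j) ≫ μ = (j ⊗ i) ≫ μ` (naturality of the braiding
and `β ≫ μ = μ`). [cite: SGA3I, VII_A 4.1] -/
theorem braiding_hom_comp_tensorHom_comp_mul {G V U : SchemeOver k} [GrpObj G] [IsCommMonObj G] (i : V ⟶ G) (jU : U ⟶ G) :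
    (β_ U V).hom ≫ (i ⊗ₘ jU) ≫ μ[G] = (jU ⊗ₘ i) ≫ μ[G] := by
  rw [← BraidedCategory.braiding_naturality_assoc, IsCommMonObj.mul_comm]

omit [IsAlgClosed k] in
/-- An epimorphism stays an epimorphism after swapping the factors (`G` commutative). [cite: SGA3I, VII_A 4.1] -/
theorem epi_tensorHom_comp_mul_swap {G V U : SchemeOver k} [GrpObj G] [IsCommMonObj G] (i : V ⟶ G) (jU : U ⟶ G)
    [Epi ((i ⊗ₘ jU) ≫ μ[G])] : Epi ((jU ⊗ₘ i) ≫ μ[G]) := by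
  rw [← braiding_hom_comp_tensorHom_comp_mul i jU]
  infer_instance

omit [IsAlgClosed k] in
-- two binders of the shape `c ≫ F^n = 1` (sources `U` and `G`): each needs the slow `One (T ⟶ G^{(p^n)})` synthesis through the transported
-- structure of the twist — the budget of ★ FrobKill `comp_relFrobeniusOver_eq_one_of_kerι_comp_eq_one`, no tactic search is widened.
set_option maxHeartbeats 400000 in
/-- **FROB-KILL on a splitting**: if `(i ⊗ jU) ≫ μ : V × G⁰ → G` is an epimorphism (e.g. an isomorphism; `G` commutative), `jU` is killed by
`F^n_{G∕k}` and `i` by the homomorphism `φ : G → G′`, then `φ ≫ F^n_{G′∕k} = 1` (★ (K-c3) `FrobKill.comp_relFrobeniusOver_eq_one_of_epi_tensorHom_mul`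
after swapping the factors). [cite: SGA3I, VII_A 4.1] -/
theorem comp_relFrobeniusOver_eq_one_of_epi_tensorHom_comp_mul {G G' V U : SchemeOver k} [GrpObj G] [GrpObj G']
    (i : V ⟶ G) (jU : U ⟶ G) (hjU : jU ≫ relFrobeniusOver p n G = 1) (φ : G ⟶ G') (hφ : i ≫ φ = 1)
    [IsCommMonObj G] [Epi ((i ⊗ₘ jU) ≫ μ[G])] : φ ≫ relFrobeniusOver p n G' = 1 := by
  haveI := epi_tensorHom_comp_mul_swap i jU
  exact FrobKill.comp_relFrobeniusOver_eq_one_of_epi_tensorHom_mul p n φ jU i hjU hφ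

/-- **`rk G⁰ = q` AND `G⁰ ≫ F^n = 1`** under the hypotheses of the assembly: `q = |V(I)(k)| ≤ |G(k)|` (§1), so `rk G⁰ ≤ q` (§3
`finrank_alg_unitComponent_le`), while `q = rk Ker F^n ≤ rk G⁰` (§2); then §2 `unitComponent_comp_relFrobeniusOver_eq_one`.
[cite: Tate1997FiniteFlatGroupSchemes, (3.7)] [cite: SGA3I, VII_A 4.1–4.3] -/
theorem finrank_alg_unitComponent_eq_and_comp_relFrobeniusOver_eq_one (G : SchemeOver k) [GrpObj G] [IsAffine G.left]
    [IsFinite G.hom] (U : SchemeOver k) [GrpObj U] [IsAffine U.left] (jU : U ⟶ G)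
    (hU : IsMonHom jU ∧ IsOpenImmersion jU.left ∧ IsClosedImmersion jU.left ∧ ConnectedSpace ↥U.left) {q : ℕ}
    (hrkG : Module.finrank k (Alg G) = q * q)
    (hrkF : Module.finrank k (Alg G ⧸ (RingHom.ker (kerι (relFrobeniusOver p n G)).left.appTop.hom : Ideal (Alg G))) = q)
    (I : Ideal (Alg G)) (hIq : Module.finrank k (Alg G ⧸ I) = q) (hIet : Etale (Motives.specOver k (Alg G ⧸ I)).hom) :
    Module.finrank k (Alg U) = q ∧ jU ≫ relFrobeniusOver p n G = 1 := by
  have hU' := hU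
  obtain ⟨hmon, hop, hcl, hconn⟩ := hU
  haveI := hmon; haveI := hop; haveI := hcl; haveI := hconn
  -- `|G(k)|` is finite (Tate's count with `Γ(G) ≠ 0`) and at least `q = |V(I)(k)|`
  have hcount := finrank_alg_eq_natCard_sections_mul G U jU
  haveI : Nontrivial (Alg G) := nontrivial_alg_of_section G η[G]
  haveI : Module.Finite k (Alg G) := Alg.moduleFinite G
  have hpos : 0 < Module.finrank k (Alg G) := Module.finrank_pos
  haveI : Finite (𝟙_ (SchemeOver k) ⟶ G) :=
    Nat.finite_of_card_ne_zero fun h => by rw [h, zero_mul] at hcount; omega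
  have hq : q ≤ Nat.card (𝟙_ (SchemeOver k) ⟶ G) := by
    rw [← hIq]; exact finrank_quotient_le_natCard_hom G I hIet
  have hUle : Module.finrank k (Alg U) ≤ q := finrank_alg_unitComponent_le G U jU hU' hrkG hq
  have hUge : q ≤ Module.finrank k (Alg U) := by
    rw [← hrkF]; exact finrank_quotient_ker_le_finrank_alg_unitComponent p n G U jU hU'
  exact ⟨le_antisymm hUle hUge, unitComponent_comp_relFrobeniusOver_eq_one p n G U jU hU' (by rw [hrkF]; exact hUle)⟩

-- as above: the statement carries `quotIncl G I ≫ φ = 1` and `φ ≫ F^n_{G′} = 1`, the proof a third `jU ≫ F^n_G = 1` (★ FrobKill budget).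
set_option maxHeartbeats 400000 in
/-- **FROB-KILL ASSEMBLY (étale kernel) — `stub_K3b` of the DICT-constructor line, unfolded.**  Let `k = k̄`, `G` a finite commutative affine
`k`-group scheme of rank `q²` with unit component `jU : G⁰ ↪ G` (homomorphic open-and-closed immersion, `G⁰` connected) and Frobenius-kernel
ideal `ker Γ(ι_{Ker F^n})` of colength `q`; let `I ⊂ Γ(G)` be a Hopf ideal of colength `q` with `V(I) = Spec (Γ(G) ⧸ I)` ÉTALE, and `φ : G → G′`
a homomorphism killing `V(I)` (`quotIncl G I ≫ φ = 1`).  Then `φ ≫ F^n_{G′∕k} = 1`.  Proof: §1 `q = |V(I)(k)| ≤ |G(k)|`; §3 `rk G⁰ ≤ q`; §2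
`G⁰ = Ker F^n`, `jU ≫ F^n = 1`, `rk G⁰ = q`; `V(I) × G⁰ ⥲ G` (`isIso_quotIncl_tensorHom_comp_mul`, the group structure on `V(I)` being ★
`exists_grpObj_isMonHom_quotIncl`); `comp_relFrobeniusOver_eq_one_of_epi_tensorHom_comp_mul`. [cite: Tate1997FiniteFlatGroupSchemes, (3.7)]
[cite: SGA3I, VII_A 4.1–4.3] -/
theorem comp_relFrobeniusOver_eq_one_of_isEtale (G G' : SchemeOver k) [GrpObj G] [IsCommMonObj G] [IsAffine G.left]
    [IsFinite G.hom] [GrpObj G']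
    (U : SchemeOver k) [GrpObj U] [IsAffine U.left] (jU : U ⟶ G)
    (hU : IsMonHom jU ∧ IsOpenImmersion jU.left ∧ IsClosedImmersion jU.left ∧ ConnectedSpace ↥U.left) {q : ℕ}
    (hrkG : Module.finrank k (Alg G) = q * q)
    (hrkF : Module.finrank k (Alg G ⧸ (RingHom.ker (kerι (relFrobeniusOver p n G)).left.appTop.hom : Ideal (Alg G))) = q)
    (φ : G ⟶ G') [IsMonHom φ] (I : Ideal (Alg G)) (hIH : I.IsHopfIdeal k)
    (hIq : Module.finrank k (Alg G ⧸ I) = q) (hIet : Etale (Motives.specOver k (Alg G ⧸ I)).hom)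
    (hφ : quotIncl G I ≫ φ = 1) :
    φ ≫ relFrobeniusOver p n G' = 1 := by
  obtain ⟨hUq, hjU⟩ := finrank_alg_unitComponent_eq_and_comp_relFrobeniusOver_eq_one p n G U jU hU hrkG hrkF I hIq hIet
  -- the closed subgroup scheme `V(I) ↪ G` (group structure from the Hopf ideal), the splitting, and FROB-KILL
  haveI := hIH
  obtain ⟨instV, hmonV⟩ := exists_grpObj_isMonHom_quotIncl G I
  letI := instV
  haveI := hmonV
  haveI := isIso_quotIncl_tensorHom_comp_mul G U jU hU hrkG hUq I hIq hIet
  exact comp_relFrobeniusOver_eq_one_of_epi_tensorHom_comp_mul p n (quotIncl G I) jU hjU φ hφ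

end Assembly

end Literature.AlgebraicGeometry.GroupSchemes.FrobKillEt

end
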